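import Summits.BirchSwinnertonDyer.Rank1Residual.GaloisImage.SupersingularExactImage
import Mathlib.NumberTheory.LegendreSymbol.QuadraticChar.Basic
import HarnessLib

/-!
# BSD rank-≤1 residual cell: on the good-supersingular TWIST rows (O8 ∩ (G) ∧ ss, `e = 2`) the
# image is also EXACTLY the normaliser of a non-split Cartan subgroup (`G_E = N(kˣ)`)

HONEST FRAMING (cell `b2b-bsdres-*`, run/shared/lean/b2b/bsd-rank1-residual/, verbatim): the goal
of the cell is to DELETE the COMBINATION-SHAPED residual classes for ALL analytic-rank `≤ 1` elliptic
curves over `ℚ` — "full BSD formula for every rank `≤ 1` curve in class C" assembled STRICTLY from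
published theorems — so that the rank-`≤ 1` remainder becomes exactly the CONSTRUCTION-SHAPED
classes, which are TYPED (missing-input Props), NOT attempted; this is not "finishing BSD".
No claim beyond stated classes; census output = EVIDENCE, never a Literature fact.  Unit
`b2b-bsdres-n1011-p04-g2` (team n1011, O8 image strand, row T-O8c, optional T15).  THEOREMS ONLY
(no definition, no named fact, no binder).

## What this file does

p252792 proved `G_V = N(kˣ)` for a curve `V` with GOOD supersingular reduction at `p ≠ 2` and
`ρ̄_{V,p}` not onto; p251588 proved `G_E ≤ N(kˣ)`, `G_E ⊄ kˣ` for a curve `E` having such a `V` as a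
quadratic twist (`ρ̄_E = ρ̄_V ⊗ χ_d`).  Here the twist rows get the EXACT image too:

* `exists_mem_unitGroup_mul_self_eq_neg_one` — a non-split Cartan subgroup `kˣ ≤ GL₂(𝔽_p)` (`p`
  odd) contains an element `i` with `i² = -1` (`k ≅ 𝔽_{p²}` and `p² ≡ 1 mod 4`:
  `FiniteField.isSquare_neg_one_iff`).
* `map_range_eq_of_forall_eq_or_eq_neg_of_sq_eq_neg_one` — if `Φ₂(ρ̄₂ σ) = ±Φ₁(ρ̄₁ σ)` for all `σ`
  and `G₁ = H` for a subgroup `H` containing such an `i`, then `G₂ = H` as well (`-1 = (±i)² ∈ G₂`,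
  so `G₂` is closed under sign and `G₂ ⊇ G₁`; `G₂ ≤ H` by `-1 ∈ H`).
* `map_range_eq_normalizer_unitGroup_of_goodSS_twist_of_not_surj` — **MAIN: if a quadratic twist
  model `Wd` of `E` has `GoodSS Wd p` (`p ≠ 2`) and `ρ̄_{E,p}` is not onto, then in every frame of
  `E[p]` the image `Φ(ρ̄_{E,p}(Γ_ℚ))` EQUALS `N(kˣ)` for a field `k ⊆ M₂(𝔽_p)` of degree `2`**;
  `hasModPImageEqNonsplitCartanNormalizer_of_goodSS_twist_of_not_surj` — hence
  `SerreUniformity.HasModPImageEqNonsplitCartanNormalizer W p` (image EXACTLY `C_ns⁺(p)`).  Census: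
  the 20 (G-ss, `e = 2`) O8 rows at `p = 5` carry the FULL label `5Nn` (20/20) — this is why.

What is NOT claimed: anything for defect `e ∈ {3, 4, 6}` or wild rows; any bound on `p`; any class
theorem.

## References

* [Serre1972] J.-P. Serre, Invent. Math. 15 (1972), §2.1 b) (`kˣ ≅ 𝔽_{p²}ˣ`), §2.2, §1.11.
* [SilvermanAEC2009] *AEC* X.5 Cor. 5.4 (`E^{(d)}[p] ≅ E[p] ⊗ χ_d`).
-/

noncomputable section

open scoped Classical
open Matrix Field WeierstrassCurve Literature.NumberTheory.EllipticCurves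
  Literature.NumberTheory.GaloisRepresentations Literature.NumberTheory.GaloisRepresentations.Serre1972
  Literature.NumberTheory.EllipticCurves.Rank1Residual Literature.NumberTheory.SerreUniformity

namespace Summit.BirchSwinnertonDyer.Rank1Residual.GaloisImage

/-! ### `-1` is a square in a non-split Cartan subgroup -/

section Group

variable {p : ℕ} [hp : Fact p.Prime]

/-- **A non-split Cartan subgroup of `GL₂(𝔽_p)`, `p` odd, contains a square root of `-1`.**  For a
subalgebra `k ⊆ M₂(𝔽_p)` which is a field of degree `2` there is `i ∈ kˣ` with `i² = -1`: `k` is a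
field with `p²` elements and `p² ≢ 3 (mod 4)`, so `-1` is a square in `k`
(`FiniteField.isSquare_neg_one_iff`). [folklore] -/
theorem exists_mem_unitGroup_mul_self_eq_neg_one (hp2 : p ≠ 2)
    {k : Subalgebra (ZMod p) (Matrix (Fin 2) (Fin 2) (ZMod p))} (hk : IsField k)
    (h2 : Module.finrank (ZMod p) k = 2) :
    ∃ i ∈ unitGroup k, i * i = -1 := by
  letI := hk.toField
  haveI : Fintype k := Fintype.ofFinite k
  have hcard : Fintype.card k = p ^ 2 := by
    rw [← Nat.card_eq_fintype_card]; exact card_eq_sq_of_finrank_eq_two h2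
  have h4 : p ^ 2 % 4 ≠ 3 := by
    have hodd : p % 2 = 1 := Nat.odd_iff.mp (hp.out.odd_of_ne_two hp2)
    have h' : p % 4 = 1 ∨ p % 4 = 3 := by omega
    rw [Nat.pow_mod]
    rcases h' with h | h <;> rw [h] <;> norm_num
  have hsq : IsSquare (-1 : k) := by
    rw [FiniteField.isSquare_neg_one_iff, hcard]; exact h4
  obtain ⟨x, hx⟩ := hsq
  have hXX : (x : Matrix (Fin 2) (Fin 2) (ZMod p)) * (x : Matrix (Fin 2) (Fin 2) (ZMod p)) = -1 := by
    have h := congrArg (fun z : k ↦ (z : Matrix (Fin 2) (Fin 2) (ZMod p))) hx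
    simp only [Subalgebra.coe_mul, Subalgebra.coe_neg, Subalgebra.coe_one] at h
    exact h.symm
  have hXdet : Matrix.det (x : Matrix (Fin 2) (Fin 2) (ZMod p)) ≠ 0 := by
    intro h0
    have h1 : Matrix.det ((x : Matrix (Fin 2) (Fin 2) (ZMod p)) * (x : Matrix (Fin 2) (Fin 2) (ZMod p))) = 1 := by
      rw [hXX, Matrix.det_neg, Matrix.det_one, Fintype.card_fin]; norm_num
    rw [Matrix.det_mul, h0, mul_zero] at h1
    exact zero_ne_one h1
  refine ⟨Matrix.GeneralLinearGroup.mkOfDetNeZero _ hXdet, ?_, ?_⟩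
  · rw [mem_unitGroup_iff]; exact x.2
  · apply Units.ext
    rw [Units.val_mul, Units.val_neg, Units.val_one]
    exact hXX

/-- **Sign-twisted images with a square root of `-1`.**  Let `Φ₂(ρ̄₂ σ) = ±Φ₁(ρ̄₁ σ)` for all `σ`
(two curves, frames related by a sign-equivariant `W₁[p] ≃+ W₂[p]`), and suppose `G₁ = H` for a
subgroup `H` containing some `i` with `i² = -1`.  Then `G₂ = H`: `±i ∈ G₂` gives `-1 = (±i)² ∈ G₂`,
so `G₂` is stable under sign and contains every `±h`, `h ∈ H`; conversely `G₂ ≤ H` as `-1 ∈ H`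
(`map_range_le_of_forall_eq_or_eq_neg`). [folklore] -/
theorem map_range_eq_of_forall_eq_or_eq_neg_of_sq_eq_neg_one {W₁ W₂ : WeierstrassCurve ℚ}
    (Φ₁ : Multiplicative (AddAut (geomTorsion W₁ p)) ≃* GL (Fin 2) (ZMod p))
    {Φ₂ : Multiplicative (AddAut (geomTorsion W₂ p)) ≃* GL (Fin 2) (ZMod p)}
    (hrel : ∀ σ : absoluteGaloisGroup ℚ,
      Φ₂ (galoisRepTorsion W₂ p σ) = Φ₁ (galoisRepTorsion W₁ p σ) ∨
        Φ₂ (galoisRepTorsion W₂ p σ) = -Φ₁ (galoisRepTorsion W₁ p σ))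
    {H : Subgroup (GL (Fin 2) (ZMod p))} {i : GL (Fin 2) (ZMod p)} (hiH : i ∈ H) (hii : i * i = -1)
    (hG₁ : (galoisRepTorsion W₁ p).range.map Φ₁.toMonoidHom = H) :
    (galoisRepTorsion W₂ p).range.map Φ₂.toMonoidHom = H := by
  set G₂ := (galoisRepTorsion W₂ p).range.map Φ₂.toMonoidHom with hG₂
  have hneg1H : (-1 : GL (Fin 2) (ZMod p)) ∈ H := by rw [← hii]; exact H.mul_mem hiH hiH
  -- every `h ∈ H` has `h ∈ G₂` or `-h ∈ G₂`
  have hpm : ∀ h ∈ H, h ∈ G₂ ∨ -h ∈ G₂ := by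
    intro h hh
    rw [← hG₁] at hh
    obtain ⟨σ, hσ⟩ := (mem_map_range_galoisRepTorsion_iff W₁ p Φ₁).mp hh
    have hmem : Φ₂ (galoisRepTorsion W₂ p σ) ∈ G₂ := apply_galoisRepTorsion_mem_map_range W₂ p Φ₂ σ
    rcases hrel σ with h' | h'
    · exact Or.inl (by rw [← hσ, ← h']; exact hmem)
    · exact Or.inr (by rw [← hσ, ← h']; exact hmem)
  -- `-1 ∈ G₂`
  have hneg1 : (-1 : GL (Fin 2) (ZMod p)) ∈ G₂ := by
    rcases hpm i hiH with h | h
    · rw [← hii]; exact G₂.mul_mem h h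
    · have : (-i) * (-i) = -1 := by rw [neg_mul_neg, hii]
      rw [← this]; exact G₂.mul_mem h h
  refine le_antisymm (map_range_le_of_forall_eq_or_eq_neg p Φ₁ hrel hneg1H hG₁.le) fun h hh ↦ ?_
  rcases hpm h hh with h' | h'
  · exact h'
  · have : h = -1 * -h := by rw [neg_one_mul, neg_neg]
    rw [this]; exact G₂.mul_mem hneg1 h'

end Group

/-! ### The twist rows: exact image -/

section Twist

variable (W : WeierstrassCurve ℚ) [W.IsElliptic] (p : ℕ) [hp : Fact p.Prime]
  (Φ : Multiplicative (AddAut (geomTorsion W p)) ≃* GL (Fin 2) (ZMod p))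
  (e : geomTorsion W p ≃+ (Fin 2 → ZMod p))
  (he : ∀ (g : Multiplicative (AddAut (geomTorsion W p))) (x : geomTorsion W p),
    e (Multiplicative.toAdd g x) =
      ((Φ g : GL (Fin 2) (ZMod p)) : Matrix (Fin 2) (Fin 2) (ZMod p)) *ᵥ e x)

include he in
/-- **MAIN — exact image on the good-supersingular twist rows.**  Let `E = W/ℚ`, `d ≠ 0`, `Wd` a
globally minimal model of `E^{(d)}` (`C • W.quadraticTwist d = Wd`) with good supersingular
reduction at `p ≠ 2`, and `ρ̄_{E,p}` not onto.  Then for every frame `Φ` of `E[p]` there is a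
field `k ⊆ M₂(𝔽_p)` of degree `2` with `Φ(ρ̄_{E,p}(Γ_ℚ)) = N(kˣ)` EXACTLY: the twist's image is
`N(kˣ)` (p252792, in the transported frame), the two images agree up to sign, and `kˣ ∋ i` with
`i² = -1`. [cite: Serre1972, §1.11 Prop. 12, §2.2, §2.7 Prop. 17] [cite: SilvermanAEC2009, X.5 Cor. 5.4] -/
theorem map_range_eq_normalizer_unitGroup_of_goodSS_twist_of_not_surj (hp2 : p ≠ 2) {d : ℚ}
    (hd : d ≠ 0) (Wd : WeierstrassCurve ℚ) [Wd.IsElliptic] [Wd.IsGloballyMinimal]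
    (hWd : ∃ C : VariableChange ℚ, C • W.quadraticTwist d = Wd) (hss : GoodSS Wd p)
    (hns : ¬ Surj W p) :
    ∃ k : Subalgebra (ZMod p) (Matrix (Fin 2) (Fin 2) (ZMod p)), IsField k ∧
      Module.finrank (ZMod p) k = 2 ∧
      (galoisRepTorsion W p).range.map Φ.toMonoidHom =
        Subgroup.normalizer (unitGroup k : Set (GL (Fin 2) (ZMod p))) := by
  obtain ⟨t, ht⟩ := exists_torsion_addEquiv_signed_of_model_twist W p Wd hd hWd
  set Φd := (AddEquiv.toMultiplicative (AddAut.congr t.symm)).trans Φ with hΦd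
  have hed := frame_transport p t Φ e he
  have hrel := apply_galoisRepTorsion_transport_eq_or_eq_neg p t Φ e he ht
  have hnsd : ¬ Surj Wd p := fun h ↦ hns ((surj_iff_of_twist_datum W p Wd hd hWd).mp h)
  obtain ⟨k, hk, h2, hGd⟩ :=
    map_range_eq_normalizer_unitGroup_of_goodSS_of_not_surj Wd p Φd (t.symm.trans e) hed hp2 hss hnsd
  obtain ⟨i, hik, hii⟩ := exists_mem_unitGroup_mul_self_eq_neg_one hp2 hk h2
  exact ⟨k, hk, h2, map_range_eq_of_forall_eq_or_eq_neg_of_sq_eq_neg_one Φd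
    (forall_eq_or_eq_neg_symm p Φ hrel) (Subgroup.le_normalizer hik) hii hGd⟩

include he in
/-- **The twist rows in the Serre-uniformity dossier's vocabulary: the image is EXACTLY `C_ns⁺(p)`**
(`HasModPImageEqNonsplitCartanNormalizer W p`) for a curve with a good supersingular quadratic
twist at `p ≠ 2` and `ρ̄_{E,p}` not onto (`e`/`Φ` any frame; frames exist,
`exists_frame_galoisRepTorsion_rat`). [cite: Serre1972, §2.2] [cite: FurioLombardo2023, (1.1)] -/
theorem hasModPImageEqNonsplitCartanNormalizer_of_goodSS_twist_of_not_surj_frame (hp2 : p ≠ 2)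
    {d : ℚ} (hd : d ≠ 0) (Wd : WeierstrassCurve ℚ) [Wd.IsElliptic] [Wd.IsGloballyMinimal]
    (hWd : ∃ C : VariableChange ℚ, C • W.quadraticTwist d = Wd) (hss : GoodSS Wd p)
    (hns : ¬ Surj W p) : HasModPImageEqNonsplitCartanNormalizer W p := by
  obtain ⟨k, hk, h2, hG⟩ :=
    map_range_eq_normalizer_unitGroup_of_goodSS_twist_of_not_surj W p Φ e he hp2 hd Wd hWd hss hns
  exact hasModPImageEqNonsplitCartanNormalizer_of_map_range_eq W p Φ e he hp2 hk h2 hG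

/-- **Frame-free: a curve with a good supersingular quadratic twist at `p ≠ 2` and `ρ̄_{E,p}` not
onto has mod-`p` image EXACTLY the normaliser of a non-split Cartan subgroup** — the O8 ∩ (G) ∧ ss,
`e = 2` rows carry the full label `pNn`. [cite: Serre1972, §2.2] [cite: SilvermanAEC2009, X.5 Cor. 5.4] -/
theorem hasModPImageEqNonsplitCartanNormalizer_of_goodSS_twist_of_not_surj (hp2 : p ≠ 2)
    {d : ℚ} (hd : d ≠ 0) (Wd : WeierstrassCurve ℚ) [Wd.IsElliptic] [Wd.IsGloballyMinimal]
    (hWd : ∃ C : VariableChange ℚ, C • W.quadraticTwist d = Wd) (hss : GoodSS Wd p)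
    (hns : ¬ Surj W p) : HasModPImageEqNonsplitCartanNormalizer W p := by
  obtain ⟨e, Φ, he, -⟩ := exists_frame_galoisRepTorsion_rat W p
  exact hasModPImageEqNonsplitCartanNormalizer_of_goodSS_twist_of_not_surj_frame W p Φ e he hp2 hd
    Wd hWd hss hns

end Twist

end Summit.BirchSwinnertonDyer.Rank1Residual.GaloisImage

end
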